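import Summits.Ventures.PercRepro.Night2GoodTwoD2Struct
import Summits.Ventures.PercRepro.Night2GoodTwoD2Axes
import Summits.Ventures.PercRepro.Night2GoodTwoD2Pairs

/-!
# night-2: at most `36` pairs load a distance-2 target

At a distance-2 target `S` (cell `(2, 1)`, at most one coloop off `K`) the loading pairs `(B, z)` — covered lossy big
pairs whose distance-2 targets contain `S` — are counted through two maps: a pair goes to its loading set
`Q = insert z B` (at most three pairs per set: `z` is one of the three coloops of `Q ∖ K`), and a loading set goes to
its AXIS `R = (Q ∖ K) ∖ coloops (Q ∖ K)` (at most four sets per axis: the two coloops of `Q ∖ K` other than the coloop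
`c` of `S ∖ K` form one of the four admissible pairs among the four points of `S ∖ K` off `R ∪ {c}`, the pairs lying
in one plane through `R` being excluded).  Two axes span different lines (the line bound of the shape of `S`), every
axis carries the points of `G ∖ K` off `clF (S.erase c)` in its plane through `c`, so there are at most three axes
(`card_axes_le_three`: one axis when those points have rank `≥ 3`, else `axis_inter_subset_clF_W`,
`card_le_one_of_subset_clF_W` and the counting lemma).  Hence `3 · 4 · 3 = 36` — paper NIGHT-2-g30 §7.4 / §7.6.
-/

namespace PercRepro.Shadow

open PercRepro.ThmH PercRepro.PerFlat

variable {α : Type*} [DecidableEq α] {M : Matroid α} [M.Finite] {G : Finset α}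

/-- **Three pairs per loading set**: the pairs `(B, z)` of `P ⊆ loadPairs` with `insert z B = Q` are at most the
coloops of `Q ∖ K` (`z` is one, and determines `B = Q.erase z`). -/
theorem card_filter_insert_eq_le_card_coloops (hG : G ∈ flatsQ M (5 + 1)) (hd : (gr M \ G).card ≤ 5)
    {P : Finset (Σ _ : Finset α, α)} (hP : P ⊆ loadPairs M G) (Q : Finset α) :
    (P.filter (fun p => insert p.2 p.1 = Q)).card ≤ (coloops M (Q \ coloops M G)).card := by
  have hGg : G ⊆ gr M := (mem_flatsQ.1 hG).1
  have hfact : ∀ p ∈ P.filter (fun p => insert p.2 p.1 = Q),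
      p.2 ∉ p.1 ∧ p.2 ∈ coloops M (Q \ coloops M G) := by
    intro p hp
    rw [Finset.mem_filter] at hp
    have hpl := mem_loadPairs.1 (hP hp.1)
    have hB : p.1 ∈ thinMembers M 5 G := hpl.1.1
    have hz : p.2 ∈ G \ clF M p.1 := hpl.2
    have hBG : p.1 ⊆ G := subset_G_of_mem_thinMembers hB
    have hzB : p.2 ∉ p.1 := fun h' => (Finset.mem_sdiff.1 hz).2 (subset_clF_of_subset_gr (hBG.trans hGg) h')
    refine ⟨hzB, mem_coloops.2 ⟨?_, ?_⟩⟩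
    · refine Finset.mem_sdiff.2 ⟨?_, ?_⟩
      · rw [← hp.2]
        exact Finset.mem_insert_self _ _
      · exact fun hK => hzB (coloops_subset_of_mem_thinMembers hG hd hB hK)
    · intro hcl
      apply (Finset.mem_sdiff.1 hz).2
      refine clF_mono ?_ hcl
      intro a ha
      rw [Finset.mem_erase, Finset.mem_sdiff, ← hp.2, Finset.mem_insert] at ha
      rcases ha.2.1 with h' | h'
      · exact absurd h' ha.1
      · exact h'
  apply Finset.card_le_card_of_injOn (fun p => p.2)
  · intro p hp
    rw [Finset.mem_coe] at hp
    rw [Finset.mem_coe]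
    exact (hfact p hp).2
  · intro p hp p' hp' heq
    rw [Finset.mem_coe] at hp hp'
    simp only at heq
    have e1 : p.1 = Q.erase p.2 := by
      rw [← (Finset.mem_filter.1 hp).2, Finset.erase_insert (hfact p hp).1]
    have e2 : p'.1 = Q.erase p'.2 := by
      rw [← (Finset.mem_filter.1 hp').2, Finset.erase_insert (hfact p' hp').1]
    have h1 : p.1 = p'.1 := by
      rw [e1, e2, heq]
    exact Sigma.ext h1 (heq_of_eq heq)

/-- The four admissible pairs: two of the points `wₐ, w_b, p₁, p₂` not in one plane through `R` (with
`p₁ ∈ clF (insert wₐ R)`, `p₂ ∈ clF (insert w_b R)`) form one of `{wₐ, w_b}`, `{wₐ, p₂}`, `{p₁, w_b}`, `{p₁, p₂}`. -/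
theorem pair_mem_four {R : Finset α} {wa wb p1 p2 u v : α}
    (hp1 : p1 ∈ clF M (insert wa R)) (hp2 : p2 ∈ clF M (insert wb R))
    (hu : u = wa ∨ u = wb ∨ u = p1 ∨ u = p2) (hv : v = wa ∨ v = wb ∨ v = p1 ∨ v = p2) (huv : u ≠ v)
    (huv' : u ∉ clF M (insert v R)) (hvu' : v ∉ clF M (insert u R)) :
    ({u, v} : Finset α) ∈ ({{wa, wb}, {wa, p2}, {p1, wb}, {p1, p2}} : Finset (Finset α)) := by
  rcases hu with rfl | rfl | rfl | rfl <;> rcases hv with rfl | rfl | rfl | rfl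
  all_goals first
    | exact absurd rfl huv
    | exact absurd hp1 hvu'
    | exact absurd hp1 huv'
    | exact absurd hp2 hvu'
    | exact absurd hp2 huv'
    | simp [Finset.pair_comm]

/-- `(R ∪ {u, v, c}) ∖ insert c R = {u, v}`. -/
theorem sdiff_insert_eq_pair {R : Finset α} {u v c : α} (hu : u ∉ R) (hv : v ∉ R) (huc : u ≠ c)
    (hvc : v ≠ c) : (R ∪ {u, v, c}) \ insert c R = {u, v} := by
  ext a
  simp only [Finset.mem_sdiff, Finset.mem_union, Finset.mem_insert, Finset.mem_singleton, not_or]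
  constructor
  · rintro ⟨h1, h2, h3⟩
    rcases h1 with h' | h' | h' | h'
    · exact absurd h' h3
    · exact Or.inl h'
    · exact Or.inr h'
    · exact absurd h' h2
  · rintro (rfl | rfl)
    · exact ⟨Or.inr (Or.inl rfl), huc, hu⟩
    · exact ⟨Or.inr (Or.inr (Or.inl rfl)), hvc, hv⟩

/-- **Two axes spanning the same line coincide** (the line bound of the shape: a rank-`2` subset of `S ∖ K` with
`≥ 4` points lies in the line `R₀` of the shape, which has as many points as an axis). -/
theorem eq_of_clF_eq_of_shape (hs : ∀ e ∈ gr M, ∀ f ∈ gr M, e ≠ f → rkN M {e, f} = 2)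
    {R₀ : Finset α} {wa wb wc p1 p2 : α} (hRg : R₀ ⊆ gr M) (hwag : wa ∈ gr M) (hwbg : wb ∈ gr M)
    (hwcg : wc ∈ gr M) (hp1g : p1 ∈ gr M) (hp2g : p2 ∈ gr M) (hR3 : 3 ≤ R₀.card)
    (hwaR : wa ∉ R₀) (hwbR : wb ∉ R₀) (hwcR : wc ∉ R₀) (hab : wa ≠ wb) (hac : wa ≠ wc) (hbc : wb ≠ wc)
    (hp1 : p1 ∉ R₀ ∪ {wa, wb, wc}) (hp2 : p2 ∉ R₀ ∪ {wa, wb, wc}) (hp12 : p1 ≠ p2)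
    (hwaH : wa ∉ clF M (R₀ ∪ {wb, wc})) (hwbH : wb ∉ clF M (R₀ ∪ {wa, wc})) (hwcH : wc ∉ clF M (R₀ ∪ {wa, wb}))
    (hp1a : p1 ∉ clF M (R₀ ∪ {wb, wc})) (hp1b : p1 ∈ clF M (R₀ ∪ {wa, wc})) (hp1c : p1 ∈ clF M (R₀ ∪ {wa, wb}))
    (hp2b : p2 ∉ clF M (R₀ ∪ {wa, wc})) (hp2a : p2 ∈ clF M (R₀ ∪ {wb, wc})) (hp2c : p2 ∈ clF M (R₀ ∪ {wa, wb}))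
    {R R' : Finset α} (hRT : R ⊆ insert p1 (insert p2 (R₀ ∪ {wa, wb, wc})))
    (hR'T : R' ⊆ insert p1 (insert p2 (R₀ ∪ {wa, wb, wc}))) (hR2 : rkN M R ≤ 2) (hcard : R'.card = R.card)
    (hR₀ : R.card = R₀.card) (hRg' : R ⊆ gr M) (hR'g : R' ⊆ gr M) (heq : clF M R = clF M R') : R = R' := by
  by_contra hne
  have hZT : R ∪ R' ⊆ insert p1 (insert p2 (R₀ ∪ {wa, wb, wc})) := Finset.union_subset hRT hR'T
  have hZcl : R ∪ R' ⊆ clF M R := by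
    refine Finset.union_subset (subset_clF_of_subset_gr hRg') ?_
    rw [heq]
    exact subset_clF_of_subset_gr hR'g
  have hZ2 : rkN M (R ∪ R') ≤ 2 := by
    have := rkN_mono (M := M) hZcl
    rw [rkN_clF] at this
    omega
  have hlt : R.card < (R ∪ R').card := by
    apply Finset.card_lt_card
    rw [Finset.ssubset_iff_subset_ne]
    refine ⟨Finset.subset_union_left, fun hZ => hne ?_⟩
    have hR'R : R' ⊆ R := by
      rw [hZ]
      exact Finset.subset_union_right
    exact (Finset.eq_of_subset_of_card_le hR'R (by omega)).symm
  by_cases hZR : R ∪ R' ⊆ R₀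
  · have := Finset.card_le_card hZR
    omega
  · have := card_le_three_of_rkN_le_two_of_shape hs hRg hwag hwbg hwcg hp1g hp2g hwaR hwbR hwcR hab hac hbc
      hp1 hp2 hp12 hwaH hwbH hwcH hp1a hp1b hp1c hp2b hp2a hp2c hZT hZ2 hZR
    omega

/-- **At most three axes**: a family `Ax` of rank-`2` subsets of `U` (`|U| ≤ r + 4`, each of `r ≥ 3` points, distinct
members spanning distinct lines) whose planes through `c ∉ clF U` all contain a set `W ∋ c, c'` has at most three
members. -/
theorem card_axes_le_three (hs : ∀ e ∈ gr M, ∀ f ∈ gr M, e ≠ f → rkN M {e, f} = 2)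
    {U : Finset α} (hUg : U ⊆ gr M) {c : α} (hcg : c ∈ gr M) (hcU : c ∉ clF M U)
    {W : Finset α} (hWg : W ⊆ gr M) (hcW : c ∈ W) {c' : α} (hc'W : c' ∈ W) (hcc' : c ≠ c')
    {r : ℕ} (hr : 3 ≤ r) (hU : U.card ≤ r + 4) {Ax : Finset (Finset α)}
    (hax : ∀ R ∈ Ax, R ⊆ U ∧ R.card = r ∧ rkN M R = 2 ∧ W ⊆ clF M (insert c R))
    (hline : ∀ R ∈ Ax, ∀ R' ∈ Ax, clF M R = clF M R' → R = R') : Ax.card ≤ 3 := by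
  by_cases hW3 : 3 ≤ rkN M W
  · -- `W` spans a plane: every axis is its trace on `U`
    have h1 : Ax.card ≤ 1 := by
      rw [Finset.card_le_one]
      intro R hR R' hR'
      obtain ⟨hRU, -, hR2, hWR⟩ := hax R hR
      obtain ⟨hR'U, -, hR'2, hWR'⟩ := hax R' hR'
      have hcR : c ∉ clF M R := fun h' => hcU (clF_mono hRU h')
      have hcR' : c ∉ clF M R' := fun h' => hcU (clF_mono hR'U h')
      have hRg : R ⊆ gr M := hRU.trans hUg
      have hR'g : R' ⊆ gr M := hR'U.trans hUg
      have hP : clF M W = clF M (insert c R) :=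
        clF_eq_clF_of_subset_clF_of_rkN_le (Finset.insert_subset hcg hRg) hWR (by
          rw [rkN_insert_of_notMem_clF hcg hcR, hR2]
          exact hW3)
      have hP' : clF M W = clF M (insert c R') :=
        clF_eq_clF_of_subset_clF_of_rkN_le (Finset.insert_subset hcg hR'g) hWR' (by
          rw [rkN_insert_of_notMem_clF hcg hcR', hR'2]
          exact hW3)
      apply hline R hR R' hR'
      apply le_antisymm
      · apply clF_subset_clF_of_subset_clF
        intro y hy
        apply mem_clF_of_mem_plane_of_mem_H hUg hR'U hR'2 hcg hcU (hRU hy)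
        rw [← hP', hP]
        exact subset_clF_of_subset_gr (Finset.insert_subset hcg hRg) (Finset.mem_insert_of_mem hy)
      · apply clF_subset_clF_of_subset_clF
        intro y hy
        apply mem_clF_of_mem_plane_of_mem_H hUg hRU hR2 hcg hcU (hR'U hy)
        rw [← hP, hP']
        exact subset_clF_of_subset_gr (Finset.insert_subset hcg hR'g) (Finset.mem_insert_of_mem hy)
    omega
  · push Not at hW3
    have hW2 : rkN M W ≤ 2 := by omega
    have hX0 : (U.filter (fun y => y ∈ clF M W)).card ≤ 1 :=
      card_le_one_of_subset_clF_W hs hUg hcU hWg hcW hW2 (fun y hy => (Finset.mem_filter.1 hy).2)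
        (Finset.filter_subset _ _)
    have hinter : ∀ R ∈ Ax, ∀ R' ∈ Ax, R ≠ R' → ∀ p ∈ R, p ∈ R' → p ∈ U.filter (fun y => y ∈ clF M W) := by
      intro R hR R' hR' hne p hpR hpR'
      obtain ⟨hRU, -, hR2, hWR⟩ := hax R hR
      obtain ⟨hR'U, -, hR'2, hWR'⟩ := hax R' hR'
      refine Finset.mem_filter.2 ⟨hRU hpR, ?_⟩
      exact axis_inter_subset_clF_W hs hUg hcg hcU hWg hcW hc'W hcc' hRU hR'U hR2 hR'2 hWR hWR'
        (fun heq => hne (hline R hR R' hR' heq)) hpR hpR'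
    rcases (U.filter (fun y => y ∈ clF M W)).eq_empty_or_nonempty with hX | ⟨p₀, hp₀⟩
    · exact card_le_three_of_pairwise_inter_subset hr hU (fun R hR => (hax R hR).1)
        (fun R hR => (hax R hR).2.1) (p₀ := c) (fun R hR R' hR' hne p hpR hpR' => by
          have := hinter R hR R' hR' hne p hpR hpR'
          rw [hX] at this
          exact absurd this (Finset.notMem_empty _))
    · exact card_le_three_of_pairwise_inter_subset hr hU (fun R hR => (hax R hR).1)
        (fun R hR => (hax R hR).2.1) (p₀ := p₀) (fun R hR R' hR' hne p hpR hpR' =>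
          Finset.card_le_one.1 hX0 p (hinter R hR R' hR' hne p hpR hpR') p₀ hp₀)

/-- **At most `36` loading pairs at a distance-2 target**: three per loading set, four sets per axis, three axes. -/
theorem card_filter_loadPairs_le_36 (hG : G ∈ flatsQ M (5 + 1)) (hd : (gr M \ G).card = 2)
    (hk : kColoops M G = 1) (hs : ∀ e ∈ gr M, ∀ f ∈ gr M, e ≠ f → rkN M {e, f} = 2)
    (hl : ∀ e ∈ gr M, M.Indep {e}) {S : Finset α} (hSG : S ⊆ G) (hKS : coloops M G ⊆ S)
    (hc1 : (coloops M (S \ coloops M G)).card ≤ 1) {B : Finset α} (hB : B ∈ thinMembers M 5 G)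
    (hbig : 5 ≤ (B \ coloops M G).card) {z : α} (hz : z ∈ G \ clF M B) (h : loss M 5 G B z ≠ 0)
    (hno : ¬ (gtPts M 5 G (insert z B)).Nonempty) (hS : S ∈ d2Targets M 5 G (insert z B)) :
    ((loadPairs M G).filter (fun p => loss M 5 G p.1 p.2 ≠ 0 ∧ ¬ (gtPts M 5 G (insert p.2 p.1)).Nonempty ∧
      S ∈ d2Targets M 5 G (insert p.2 p.1))).card ≤ 36 := by
  have hd' : (gr M \ G).card ≤ 5 := by omega
  have hGg : G ⊆ gr M := (mem_flatsQ.1 hG).1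
  obtain ⟨c, hc⟩ := coloops_nonempty_of_mem_d2Targets hG hd hk hs hl hB hbig hz h hno hS
  set P := (loadPairs M G).filter (fun p => loss M 5 G p.1 p.2 ≠ 0 ∧
    ¬ (gtPts M 5 G (insert p.2 p.1)).Nonempty ∧ S ∈ d2Targets M 5 G (insert p.2 p.1)) with hPdef
  have hPsub : P ⊆ loadPairs M G := Finset.filter_subset _ _
  have hpair : ∀ p ∈ P, (p.1 ∈ thinMembers M 5 G ∧ 5 ≤ (p.1 \ coloops M G).card) ∧ p.2 ∈ G \ clF M p.1 ∧
      loss M 5 G p.1 p.2 ≠ 0 ∧ ¬ (gtPts M 5 G (insert p.2 p.1)).Nonempty ∧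
      S ∈ d2Targets M 5 G (insert p.2 p.1) := by
    intro p hp
    rw [hPdef, Finset.mem_filter, mem_loadPairs] at hp
    exact ⟨hp.1.1, hp.1.2, hp.2⟩
  -- Step 1: at most three pairs per loading set
  have hstep1 : P.card ≤ 3 * (P.image (fun p => insert p.2 p.1)).card := by
    apply Finset.card_le_mul_card_image P 3
    intro Q hQ
    obtain ⟨p₀, hp₀, rfl⟩ := Finset.mem_image.1 hQ
    obtain ⟨⟨hB₀, hbig₀⟩, hz₀, hl₀, -, -⟩ := hpair p₀ hp₀
    have h3 := card_coloops_eq_three_of_loss_ne_zero hG hd hk hs hl hB₀ hbig₀ hz₀ hl₀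
    calc (P.filter (fun p => insert p.2 p.1 = insert p₀.2 p₀.1)).card
        ≤ (coloops M (insert p₀.2 p₀.1 \ coloops M G)).card :=
          card_filter_insert_eq_le_card_coloops hG hd' hPsub _
      _ = 3 := h3
  set 𝒬 := P.image (fun p => insert p.2 p.1) with h𝒬
  set Axes := 𝒬.image (fun Q => (Q \ coloops M G) \ coloops M (Q \ coloops M G)) with hAxes
  -- Step 2: at most four loading sets per axis
  have hstep2 : 𝒬.card ≤ 4 * Axes.card := by
    apply Finset.card_le_mul_card_image 𝒬 4
    intro R hR
    obtain ⟨Q₁, hQ₁, hRQ₁⟩ := Finset.mem_image.1 hR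
    obtain ⟨p₁, hp₁, rfl⟩ := Finset.mem_image.1 hQ₁
    obtain ⟨⟨hB₁, hbig₁⟩, hz₁, hl₁, hno₁, hS₁⟩ := hpair p₁ hp₁
    obtain ⟨wa, wb, p1, p2, -, -, hSK, -, -, -, -, -, -, -, -, -, -, -, -, -, -, -, -, -, -, -, -, hp1a, -,
      hp2b, -, -⟩ := loading_structure hG hd hk hs hl hc hc1 hB₁ hbig₁ hz₁ hl₁ hno₁ hS₁ hRQ₁.symm
    refine le_trans ?_ (Finset.card_le_four (a := ({wa, wb} : Finset α)) (b := {wa, p2}) (c := {p1, wb})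
      (d := {p1, p2}))
    -- the key facts of a loading set with axis `R`
    have hkey : ∀ Q ∈ 𝒬, (Q \ coloops M G) \ coloops M (Q \ coloops M G) = R →
        ∃ u v : α, coloops M (Q \ coloops M G) = {u, v, c} ∧ Q \ coloops M G = R ∪ {u, v, c} ∧
          coloops M G ⊆ Q ∧ u ∉ R ∧ v ∉ R ∧ u ≠ v ∧ u ≠ c ∧ v ≠ c ∧
          (u = wa ∨ u = wb ∨ u = p1 ∨ u = p2) ∧ (v = wa ∨ v = wb ∨ v = p1 ∨ v = p2) ∧
          u ∉ clF M (insert v R) ∧ v ∉ clF M (insert u R) := by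
      intro Q hQ hQR
      obtain ⟨p, hp, rfl⟩ := Finset.mem_image.1 hQ
      obtain ⟨⟨hB', hbig'⟩, hz', hl', hno', hS'⟩ := hpair p hp
      obtain ⟨u, v, q1, q2, hcol', hQK', hSK', -, -, -, -, huR, hvR, -, huv, huc, hvc, -, -, -, -, -, -, -,
        -, -, -, -, -, -, -, -⟩ :=
        loading_structure hG hd hk hs hl hc hc1 hB' hbig' hz' hl' hno' hS' hQR.symm
      have hKQ : coloops M G ⊆ insert p.2 p.1 :=
        (coloops_subset_of_mem_thinMembers hG hd' hB').trans (Finset.subset_insert _ _)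
      have hmem : ∀ x, x ∈ R ∪ {u, v, c} → x ∉ R → x ≠ c → x = wa ∨ x = wb ∨ x = p1 ∨ x = p2 := by
        intro x hx hxR hxc
        have hxS : x ∈ S \ coloops M G := by
          rw [hSK']
          exact Finset.mem_insert_of_mem (Finset.mem_insert_of_mem hx)
        rw [hSK] at hxS
        simp only [Finset.mem_insert, Finset.mem_union, Finset.mem_singleton] at hxS
        rcases hxS with h' | h' | h' | h' | h' | h'
        · exact Or.inr (Or.inr (Or.inl h'))
        · exact Or.inr (Or.inr (Or.inr h'))
        · exact absurd h' hxR
        · exact Or.inl h'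
        · exact Or.inr (Or.inl h')
        · exact absurd h' hxc
      have hucol : u ∈ coloops M (insert p.2 p.1 \ coloops M G) := by
        rw [hcol']
        simp
      have hvcol : v ∈ coloops M (insert p.2 p.1 \ coloops M G) := by
        rw [hcol']
        simp
      refine ⟨u, v, hcol', hQK', hKQ, huR, hvR, huv, huc, hvc, hmem u (by simp) huR huc,
        hmem v (by simp) hvR hvc, ?_, ?_⟩
      · intro hcl
        apply (mem_coloops.1 hucol).2
        refine clF_mono ?_ hcl
        intro a ha
        rw [Finset.mem_insert] at ha
        rw [Finset.mem_erase, hQK']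
        rcases ha with h' | ha
        · exact ⟨h' ▸ huv.symm, h' ▸ (by simp)⟩
        · exact ⟨fun h' => huR (h' ▸ ha), Finset.mem_union_left _ ha⟩
      · intro hcl
        apply (mem_coloops.1 hvcol).2
        refine clF_mono ?_ hcl
        intro a ha
        rw [Finset.mem_insert] at ha
        rw [Finset.mem_erase, hQK']
        rcases ha with h' | ha
        · exact ⟨h' ▸ huv, h' ▸ (by simp)⟩
        · exact ⟨fun h' => hvR (h' ▸ ha), Finset.mem_union_left _ ha⟩
    apply Finset.card_le_card_of_injOn (fun Q => (Q \ coloops M G) \ insert c R)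
    · intro Q hQ
      rw [Finset.mem_coe, Finset.mem_filter] at hQ
      obtain ⟨u, v, -, hQK', -, huR, hvR, huv, huc, hvc, hu, hv, huv', hvu'⟩ := hkey Q hQ.1 hQ.2
      rw [Finset.mem_coe]
      simp only
      rw [hQK', sdiff_insert_eq_pair huR hvR huc hvc]
      exact pair_mem_four hp1a hp2b hu hv huv huv' hvu'
    · intro Q hQ Q' hQ' heq
      rw [Finset.mem_coe, Finset.mem_filter] at hQ hQ'
      simp only at heq
      have key : ∀ Q ∈ 𝒬, (Q \ coloops M G) \ coloops M (Q \ coloops M G) = R →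
          Q = coloops M G ∪ (insert c R ∪ ((Q \ coloops M G) \ insert c R)) := by
        intro Q hQ hQR
        obtain ⟨u, v, -, hQK', hKQ, -, -, -, -, -, -, -, -, -⟩ := hkey Q hQ hQR
        have hsub : insert c R ⊆ Q \ coloops M G := by
          rw [hQK']
          intro a ha
          rw [Finset.mem_insert] at ha
          rcases ha with h' | ha
          · rw [h']
            simp
          · exact Finset.mem_union_left _ ha
        rw [Finset.union_sdiff_of_subset hsub, Finset.union_sdiff_of_subset hKQ]
      calc Q = coloops M G ∪ (insert c R ∪ ((Q \ coloops M G) \ insert c R)) := key Q hQ.1 hQ.2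
        _ = coloops M G ∪ (insert c R ∪ ((Q' \ coloops M G) \ insert c R)) := by rw [heq]
        _ = Q' := (key Q' hQ'.1 hQ'.2).symm
  -- Step 3: at most three axes
  have hstep3 : Axes.card ≤ 3 := by
    have hcSK : c ∈ S \ coloops M G := (mem_coloops.1 hc).1
    have hcG : c ∈ G := hSG (Finset.mem_sdiff.1 hcSK).1
    have hcg : c ∈ gr M := hGg hcG
    have hUg : (S \ coloops M G).erase c ⊆ gr M :=
      (Finset.erase_subset _ _).trans (Finset.sdiff_subset.trans (hSG.trans hGg))
    have hcU : c ∉ clF M ((S \ coloops M G).erase c) := (mem_coloops.1 hc).2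
    have hWg : (G \ coloops M G) \ clF M (S.erase c) ⊆ gr M :=
      Finset.sdiff_subset.trans (Finset.sdiff_subset.trans hGg)
    have hcW : c ∈ (G \ coloops M G) \ clF M (S.erase c) := by
      refine Finset.mem_sdiff.2 ⟨Finset.mem_sdiff.2 ⟨hcG, (Finset.mem_sdiff.1 hcSK).2⟩, ?_⟩
      exact (mem_coloops.1 (mem_coloops_of_mem_coloops_sdiff hG hk hSG hc)).2
    obtain ⟨c', hc'W, hc'c⟩ := exists_ne_of_mem_coloops_sdiff hG hk hSG hKS hc
    -- the shape of `S` (from the given pair), for the line bound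
    obtain ⟨R₀, wa, wb, wc, p1, p2, hSK₀, -, -, hR₀3, hR₀G, hwaR, hwbR, hwcR, hab, hac, hbc, hp1, hp2, hp12,
      hp1G, hp2G, hwaG, hwbG, hwcG, hwaH, hwbH, hwcH, hp1a, hp1b, hp1c, hp2b, hp2a, hp2c⟩ :=
      d2Target_shape hG hd hk hs hl hB hbig hz h hno hS
    have hcard₀ : (S \ coloops M G).card = R₀.card + 5 := by
      rw [hSK₀]
      exact card_shape hwaR hwbR hwcR hab hac hbc hp1 hp2 hp12
    have hax : ∀ R ∈ Axes, R ⊆ (S \ coloops M G).erase c ∧ R.card = (S \ coloops M G).card - 5 ∧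
        rkN M R = 2 ∧ (G \ coloops M G) \ clF M (S.erase c) ⊆ clF M (insert c R) := by
      intro R hR
      obtain ⟨Q, hQ, hRQ⟩ := Finset.mem_image.1 hR
      obtain ⟨p, hp, rfl⟩ := Finset.mem_image.1 hQ
      obtain ⟨⟨hB', hbig'⟩, hz', hl', hno', hS'⟩ := hpair p hp
      obtain ⟨u, v, q1, q2, -, -, hSK', hcard', hR2, -, -, -, -, hcR, -, -, -, -, -, -, -, -, -, -, -, -, -,
        -, -, -, -, hW⟩ :=
        loading_structure hG hd hk hs hl hc hc1 hB' hbig' hz' hl' hno' hS' hRQ.symm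
      refine ⟨?_, by omega, hR2, hW⟩
      intro a ha
      refine Finset.mem_erase.2 ⟨fun h' => hcR (h' ▸ ha), ?_⟩
      rw [hSK']
      exact Finset.mem_insert_of_mem (Finset.mem_insert_of_mem (Finset.mem_union_left _ ha))
    have hUT : (S \ coloops M G).erase c ⊆ insert p1 (insert p2 (R₀ ∪ {wa, wb, wc})) := by
      rw [← hSK₀]
      exact Finset.erase_subset _ _
    have hline : ∀ R ∈ Axes, ∀ R' ∈ Axes, clF M R = clF M R' → R = R' := by
      intro R hR R' hR' heq
      obtain ⟨hRU, hRc, hR2, -⟩ := hax R hR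
      obtain ⟨hR'U, hR'c, -, -⟩ := hax R' hR'
      exact eq_of_clF_eq_of_shape hs (hR₀G.trans hGg) (hGg hwaG) (hGg hwbG) (hGg hwcG) (hGg hp1G) (hGg hp2G)
        hR₀3 hwaR hwbR hwcR hab hac hbc hp1 hp2 hp12 hwaH hwbH hwcH hp1a hp1b hp1c hp2b hp2a hp2c
        (hRU.trans hUT) (hR'U.trans hUT) (by omega) (by omega) (by omega) (hRU.trans hUg) (hR'U.trans hUg) heq
    have hcardU : ((S \ coloops M G).erase c).card ≤ ((S \ coloops M G).card - 5) + 4 := by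
      rw [Finset.card_erase_of_mem hcSK]
      omega
    exact card_axes_le_three hs hUg hcg hcU hWg hcW hc'W hc'c.symm (by omega) hcardU hax hline
  calc P.card ≤ 3 * 𝒬.card := hstep1
    _ ≤ 3 * (4 * Axes.card) := Nat.mul_le_mul_left 3 hstep2
    _ ≤ 3 * (4 * 3) := Nat.mul_le_mul_left 3 (Nat.mul_le_mul_left 4 hstep3)
    _ = 36 := by norm_num

/-- **At most `36` pairs have a nonzero `dshGT2` term at a distance-2 target** (paper NIGHT-2-g30 §7.4): the
hypothesis `hcount` of `dload_gt2_le_cap2_of_card_coloops_le_one_of_count`. -/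
theorem card_loadPairs_le_36 (hG : G ∈ flatsQ M (5 + 1)) (hd : (gr M \ G).card = 2)
    (hk : kColoops M G = 1) (hs : ∀ e ∈ gr M, ∀ f ∈ gr M, e ≠ f → rkN M {e, f} = 2)
    (hl : ∀ e ∈ gr M, M.Indep {e}) {S : Finset α} (hSG : S ⊆ G) (hKS : coloops M G ⊆ S)
    (hc1 : (coloops M (S \ coloops M G)).card ≤ 1) {B : Finset α} (hB : B ∈ thinMembers M 5 G)
    (hbig : 5 ≤ (B \ coloops M G).card) {z : α} (hz : z ∈ G \ clF M B) (h : loss M 5 G B z ≠ 0)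
    (hno : ¬ (gtPts M 5 G (insert z B)).Nonempty) (hS : S ∈ d2Targets M 5 G (insert z B)) :
    ((loadPairs M G).filter (fun p => dshGT2 M 5 G p.1 p.2 S ≠ 0)).card ≤ 36 := by
  refine le_trans (Finset.card_le_card (Finset.monotone_filter_right _ ?_))
    (card_filter_loadPairs_le_36 hG hd hk hs hl hSG hKS hc1 hB hbig hz h hno hS)
  intro p hp hne
  have hpl := mem_loadPairs.1 hp
  exact d2_of_dshGT2_ne_zero hG hd hk hs hl hB hbig hz h hno hS hpl.1.1 hpl.2 hne

end PercRepro.Shadow
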